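import Mathlib
import Summits.PneNP.PneNP.Theorems.Nc03AvoidResidualCoreReductionAssembly
import Literature.Computability.Complexity.CodeFPFinite

/-!
# Route Nc03AvoidResidualCore, item `ResidualCoreReduction` — the solver, XVIII: the assembled solver is polynomial time

Helper file for `stmt-PneNP-20227` (sequel of `…ReductionAssembly`; cell pnp-ideate). `CodeFP`
proofs for the assembly: the NPN data of a record (a finite table on the 256 table bytes,
`CodeFP.ofFintype`), buckets, the raw relaxed bucket `pureOf`, the class choice, the dispatch,
and the scatter (in an enumeration form `scatter2 = scatter`); hence `codeFP_outBits` and, composed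
with the parser, `codeFP_solver : CodeFP eIn strE (outBits f₀ ∘ toRaw)` for any polynomial-time
oracle `f₀`.
-/

set_option linter.dupNamespace false -- `Summit.PneNP.PneNP.…`: summit = sub-problem name (D-0017 single-conjunct layout)

namespace Summit.PneNP.PneNP.Theorems.Nc03Reduction

open Literature.Computability.Complexity CodeFP

/-! ## Finite tables on table bytes -/

/-- The code of a table byte is injective. -/
theorem tabE_injective : Function.Injective tabE := fun _ _ h => List.ofFn_injective h

/-- The class of a record is polynomial time. -/
theorem codeFP_clsOf : CodeFP recE natE clsOf :=
  ((ofFintype tabE_injective natE (fun T : Fin 8 → Bool => (npnB T).1)).comp (fst _ _)).congr fun _ => rfl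

/-- The output negation of a record is polynomial time. -/
theorem codeFP_negOf : CodeFP recE bitE negOf :=
  ((ofFintype tabE_injective bitE (fun T : Fin 8 → Bool => (npnB T).2.2.2)).comp (fst _ _)).congr fun _ => rfl

/-- The role selected for position `i` of the relaxed output, as a number `< 3`. -/
def selIdx (i : Fin 3) (T : Fin 8 → Bool) : ℕ := (perm (npnB T).2.1 i).val

/-- The additive offset `2i + s` of position `i` of the relaxed output. -/
def offs (i : Fin 3) (T : Fin 8 → Bool) : ℕ := 2 * i.val + if maskBit (npnB T).2.2.1 i then 1 else 0

/-- Picking a variable of a record by role number. -/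
def pickVar (r : Rec) (k : ℕ) : ℕ := if decide (k = 0) then r.2.1 else if decide (k = 1) then r.2.2.1 else r.2.2.2

/-- `selVar` through `pickVar`. -/
theorem selVar_eq_pickVar (r : Rec) (j : Fin 3) : selVar r j = pickVar r j.val := by
  fin_cases j <;> rfl

/-- `pureVar` through the finite tables. -/
theorem pureVar_eq (r : Rec) (i : Fin 3) : pureVar r i = 6 * pickVar r (selIdx i r.1) + offs i r.1 := by
  unfold pureVar selIdx offs; rw [selVar_eq_pickVar]

/-- `pickVar` is polynomial time (record variables are unary). -/
theorem codeFP_pickVar : CodeFP (pairE recE natE) natE (fun q => pickVar q.1 q.2) := by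
  have ha : CodeFP (pairE recE natE) natE (fun q => q.1.2.1) := natOfUn.comp (fst _ _).snd'.fst'
  have hb : CodeFP (pairE recE natE) natE (fun q => q.1.2.2.1) := natOfUn.comp (fst _ _).snd'.snd'.fst'
  have hc : CodeFP (pairE recE natE) natE (fun q => q.1.2.2.2) := natOfUn.comp (fst _ _).snd'.snd'.snd'
  exact (CodeFP.ite (codeFP_eqTest (snd _ _) (const _ 0)) ha
    (CodeFP.ite (codeFP_eqTest (snd _ _) (const _ 1)) hb hc)).congr fun _ => rfl

/-- `pureVar` is polynomial time, for each position. -/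
theorem codeFP_pureVar (i : Fin 3) : CodeFP recE natE (fun r => pureVar r i) := by
  have hs : CodeFP recE natE (fun r => selIdx i r.1) := (ofFintype tabE_injective natE (selIdx i)).comp (fst _ _)
  have ho : CodeFP recE natE (fun r => offs i r.1) := (ofFintype tabE_injective natE (offs i)).comp (fst _ _)
  have hp : CodeFP recE natE (fun r => pickVar r (selIdx i r.1)) := codeFP_pickVar.comp ((CodeFP.id _).pair hs)
  exact ((natAdd.comp ((natMul.comp ((const _ 6).pair hp)).pair ho)).congr fun r => by
    show 6 * pickVar r (selIdx i r.1) + offs i r.1 = pureVar r i; rw [pureVar_eq])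

/-- `pureTriple` is polynomial time. -/
theorem codeFP_pureTriple : CodeFP recE tripE pureTriple :=
  ((codeFP_pureVar 0).pair ((codeFP_pureVar 1).pair (codeFP_pureVar 2))).congr fun _ => rfl

/-! ## Buckets, the raw relaxed bucket, the class choice -/

/-- Buckets are polynomial time. -/
theorem codeFP_bucket : CodeFP (pairE (rawE recE) natE) (rawE (pairE natE recE)) (fun q => bucket q.1 q.2) := by
  have hp : CodeFP (pairE natE (pairE natE recE)) bitE (fun y => decide (clsOf y.2.2 = y.1)) :=
    codeFP_eqTest (codeFP_clsOf.comp (snd _ _).snd') (fst _ _)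
  exact ((filter hp).comp ((snd _ _).pair ((rawEnum recE).comp (fst _ _)))).congr fun _ => rfl

/-- The raw relaxed bucket is polynomial time. -/
theorem codeFP_pureOf : CodeFP (pairE riE natE) prE (fun q => pureOf q.1 q.2) := by
  have hb : CodeFP (pairE riE natE) (rawE (pairE natE recE)) (fun q => bucket q.1.2.2 q.2) :=
    (codeFP_bucket.comp ((fst _ _).snd'.snd'.pair (snd _ _))).congr fun _ => rfl
  have hN : CodeFP (pairE riE natE) unE (fun q => 6 * q.1.1) := (unMulConst 6).comp (fst _ _).fst'
  have hM : CodeFP (pairE riE natE) unE (fun q => (bucket q.1.2.2 q.2).length) := (ulength _).comp hb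
  have hT : CodeFP (pairE riE natE) (rawE tripE) (fun q => (bucket q.1.2.2 q.2).map fun x => pureTriple x.2) :=
    (map₀ (codeFP_pureTriple.comp (snd natE recE))).comp hb
  exact (hN.pair (hM.pair hT)).congr fun q => by unfold pureOf; rfl

/-- Bucket sizes are polynomial time. -/
theorem codeFP_cntC : CodeFP (pairE (rawE recE) natE) natE (fun q => cntC q.1 q.2) :=
  ((natLength _).comp codeFP_bucket).congr fun _ => rfl

/-- The threshold table is polynomial time. -/
theorem codeFP_thr : CodeFP natE natE thr :=
  ((rawGetD natE (d := 0) (by decide)).comp ((const natE thrTab).pair (CodeFP.id natE))).congr fun _ => rfl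

/-- The class test is polynomial time. -/
theorem codeFP_classOK : CodeFP (pairE riE natE) bitE (fun q => classOK q.1 q.2) := by
  have h1 : CodeFP (pairE riE natE) natE (fun q => thr q.2 * (6 * q.1.1)) :=
    natMul.comp ((codeFP_thr.comp (snd _ _)).pair (natMul.comp ((const _ 6).pair (natOfUn.comp (fst _ _).fst'))))
  have h2 : CodeFP (pairE riE natE) natE (fun q => cntC q.1.2.2 q.2) :=
    codeFP_cntC.comp ((fst _ _).snd'.snd'.pair (snd _ _))
  exact (natLt.comp (h1.pair h2)).congr fun _ => rfl

/-- The class choice is polynomial time. -/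
theorem codeFP_chooseClass : CodeFP riE natE chooseClass := by
  have hf : CodeFP riE (optE natE) (fun ri => (List.range 13).find? fun c => classOK ri c) :=
    ((rawFind? codeFP_classOK).comp ((CodeFP.id _).pair (const _ (List.range 13)))).congr fun _ => rfl
  exact ((optGetD natE).comp (hf.pair (const _ 13))).congr fun _ => rfl

/-! ## Dispatch -/

/-- The dispatch is polynomial time (for a polynomial-time oracle). -/
theorem codeFP_solveC {f₀ : List Bool → List Bool} (hf₀ : IsPolyTime f₀) :
    CodeFP (pairE natE prE) (rawE bitE) (fun q => solveC f₀ q.1 q.2) := by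
  have t : ∀ k : ℕ, CodeFP (pairE natE prE) bitE (fun q => decide (q.1 = k)) := fun k => codeFP_eqTest (fst _ _) (const _ k)
  have b : ∀ {g : PRaw → List Bool}, CodeFP prE (rawE bitE) g → CodeFP (pairE natE prE) (rawE bitE) (fun q => g q.2) :=
    fun hg => hg.comp (snd _ _)
  exact ((t 0).ite (b codeFP_sol0) ((t 1).ite (b codeFP_sol1) ((t 2).ite (b codeFP_sol2) ((t 3).ite (b codeFP_sol3)
    ((t 4).ite (b codeFP_sol4) ((t 5).ite (b codeFP_sol5) ((t 6).ite (b codeFP_sol6) ((t 7).ite (b codeFP_sol7)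
    ((t 8).ite (b codeFP_sol8) ((t 9).ite (b codeFP_sol9) ((t 10).ite (b codeFP_sol10) ((t 11).ite (b codeFP_sol11)
    ((t 12).ite (b codeFP_sol12) (b (codeFP_sol13 hf₀))))))))))))))).congr fun q => by unfold solveC; rfl

/-! ## Scatter in enumeration form -/

/-- Lookup through `Option.elim`. -/
def lookupBit2 (A : List ((ℕ × Rec) × Bool)) (j : ℕ) : Bool :=
  (A.find? fun t => decide (t.1.1 = j)).elim false fun t => t.2

/-- The two lookups agree. -/
theorem lookupBit2_eq (A : List ((ℕ × Rec) × Bool)) (j : ℕ) : lookupBit2 A j = lookupBit A j := by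
  unfold lookupBit2 lookupBit
  cases A.find? (fun t => decide (t.1.1 = j)) <;> rfl

/-- Scatter over the enumerated records. -/
def scatter2 (recs : List Rec) (c : ℕ) (y' : List Bool) : List Bool :=
  ((List.range recs.length).zip recs).map fun q => xor (lookupBit2 ((bucket recs c).zip y') q.1) (negOf q.2)

/-- The two scatters agree. -/
theorem scatter2_eq (recs : List Rec) (c : ℕ) (y' : List Bool) : scatter2 recs c y' = scatter recs c y' := by
  unfold scatter2 scatter
  apply List.ext_getElem
  · simp
  · intro i h1 h2
    rw [List.getElem_map, List.getElem_map, List.getElem_zip, List.getElem_range, lookupBit2_eq]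
    simp only [List.length_map, List.length_range] at h2
    rw [List.getD_eq_getElem?_getD, List.getElem?_eq_getElem h2, Option.getD_some]

/-- The lookup is polynomial time. -/
theorem codeFP_lookupBit2 :
    CodeFP (pairE (rawE (pairE (pairE natE recE) bitE)) natE) bitE (fun q => lookupBit2 q.1 q.2) := by
  have hp : CodeFP (pairE natE (pairE (pairE natE recE) bitE)) bitE (fun y => decide (y.2.1.1 = y.1)) :=
    codeFP_eqTest (snd _ _).fst'.fst' (fst _ _)
  have hf : CodeFP (pairE (rawE (pairE (pairE natE recE) bitE)) natE) (optE (pairE (pairE natE recE) bitE))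
      (fun q => q.1.find? fun t => decide (t.1.1 = q.2)) :=
    ((rawFind? hp).comp ((snd _ _).pair (fst _ _))).congr fun _ => rfl
  have hk := optCases (σ := List ((ℕ × Rec) × Bool) × ℕ) (eσ := pairE (rawE (pairE (pairE natE recE) bitE)) natE)
    (eα := pairE (pairE natE recE) bitE) (eδ := bitE) (k := fun _ o => o.elim false fun t => t.2)
    (gnone := fun _ => false) (gsome := fun y => y.2.2) (const _ false) (snd _ _).snd' (fun _ => rfl) (fun _ _ => rfl)
  exact (hk.comp ((CodeFP.id _).pair hf)).congr fun _ => rfl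

/-- The scatter is polynomial time. -/
theorem codeFP_scatter2 :
    CodeFP (pairE (rawE recE) (pairE natE (rawE bitE))) (rawE bitE) (fun q => scatter2 q.1 q.2.1 q.2.2) := by
  have hA : CodeFP (pairE (rawE recE) (pairE natE (rawE bitE))) (rawE (pairE (pairE natE recE) bitE))
      (fun q => (bucket q.1 q.2.1).zip q.2.2) :=
    (rawZip _ _).comp ((codeFP_bucket.comp ((fst _ _).pair (snd _ _).fst')).pair (snd _ _).snd')
  have hi : CodeFP (pairE (pairE (rawE recE) (pairE natE (rawE bitE))) (pairE natE recE)) bitE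
      (fun y => xor (lookupBit2 ((bucket y.1.1 y.1.2.1).zip y.1.2.2) y.2.1) (negOf y.2.2)) :=
    ((codeFP_lookupBit2.comp ((hA.comp (fst _ _)).pair (snd _ _).fst')).xor (codeFP_negOf.comp (snd _ _).snd')).congr
      fun _ => rfl
  exact ((map hi).comp ((CodeFP.id _).pair ((rawEnum recE).comp (fst _ _)))).congr fun _ => rfl

/-! ## The whole solver -/

/-- **The assembled solver on raw instances is polynomial time.** -/
theorem codeFP_outBits {f₀ : List Bool → List Bool} (hf₀ : IsPolyTime f₀) : CodeFP riE (rawE bitE) (outBits f₀) := by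
  have hc : CodeFP riE natE chooseClass := codeFP_chooseClass
  have hpr : CodeFP riE prE (fun ri => pureOf ri (chooseClass ri)) := codeFP_pureOf.comp ((CodeFP.id _).pair hc)
  have hy : CodeFP riE (rawE bitE) (fun ri => solveC f₀ (chooseClass ri) (pureOf ri (chooseClass ri))) :=
    ((codeFP_solveC hf₀).comp (hc.pair hpr)).congr fun _ => rfl
  have hs : CodeFP riE (rawE bitE) (fun ri => scatter2 ri.2.2 (chooseClass ri) (solveC f₀ (chooseClass ri) (pureOf ri (chooseClass ri)))) :=
    (codeFP_scatter2.comp ((snd _ _).snd'.pair (hc.pair hy))).congr fun _ => rfl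
  exact hs.congr fun ri => by unfold outBits; rw [scatter2_eq]

/-- **The solver, from input codes to output strings, is polynomial time.** -/
theorem codeFP_solver {f₀ : List Bool → List Bool} (hf₀ : IsPolyTime f₀) :
    CodeFP eIn strE (fun x => outBits f₀ (toRaw x)) :=
  (bitsToStr.comp ((codeFP_outBits hf₀).comp codeFP_toRaw)).congr fun _ => rfl

end Summit.PneNP.PneNP.Theorems.Nc03Reduction
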